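import Mathlib
import Summits.Ventures.PercRepro2.PMK5PendantBMasses

/-!
# THEOREM 20 — THE EQUALITY LOCUS OF (HCOV) ON THE SIX-VERTEX FAMILY `K₅ + a₃ PENDANT AT b`
(blind cell PercRepro2, mine-2 g24; the lens «equality locus first» on the second six-vertex pendant family
(`K5.PendantB.ends6b`: `K₅` on `o = 0, a₁ = 1, a₂ = 2, u = 3, b = 4` plus the pendant edge `{4, 5}` to the leaf
`a₃ = 5` at `b`), every weight vector; on `PMK5PendantBMasses.lean` (p1 g7's pendant-at-`b` Bernstein form
`gc6b_eq` with the four slacks `Z_L, Z_H, Y_L, Y_H ≥ 0`), the `a₃`-inactive locus `RuleA` (`PMK5LocusI*`,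
Theorem 19 (b)) and the `Y`-locus `RuleY` (`PMK5LocusY*`))

Write `q = p 10` for the pendant weight and `s = p ∘ castSucc` for the `K₅` weights, `S ⊆ K₅` (mask `m`) for the base
edge set.  `2P (Z_L + Z_H)` is the `a₃`-inactive value `I` (locus `RuleA`: the root pair separates `o` from `b`, or a
root cannot reach `o` avoiding the other root — 560 / 1,024), `Y_L + Y_H` is the `Y`-form (locus `RuleY`: `o` is cut
off from one of `a₁, a₂, b` by the other two — 744 / 1,024), and **`RuleA ⊆ RuleY`** (`ruleY_of_ruleA`, one
`decide +kernel`; census two own codes — the Kronecker class sums and the exact centre values of `Gc` on `ends6b`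
at `q = 0, ½, 1`: zero faces 560 / 560 / 744, 1,024 / 1,024 identical with `RuleA` / `RuleA` / `RuleY`).  Hence:
* **`gc6b_zero_of_face`** — on every `A`-degenerate base edge set `Gc ≡ 0` for EVERY pendant weight `q ∈ [0, 1]`;
* **`gc6b_pos_of_face`** — on every base edge set that is not `A`-degenerate, `Gc > 0` at every weight vector
  interior on the base with `0 ≤ q < 1` (the first Bernstein term alone);
* the «iff»s **`gc6b_pos_iff`** / **`gc6b_zero_iff`**: for every `q ∈ [0, 1)` the locus of (HCOV) on the family
  `K₅ + a₃ pendant at b` is EXACTLY the `a₃`-isolated locus `RuleA` — attaching `a₃` to `b` creates no equality;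
* the glued face `q = 1` (`a₃ = b`, the four-mark coincidence): **`gc6b_glued_zero_iff`** — `Gc ≡ 0` ⟺ `RuleY`.
Standard axioms.
-/

namespace Summit.Ventures.PercRepro2

open Hub CovForm

namespace K5

namespace PM

/-! ## The inclusion of the loci (kernel) -/

set_option maxRecDepth 100000 in
/-- **Every `A`-degenerate edge set is `Y`-degenerate** (560 ⊆ 744). -/
theorem ruleY_of_ruleA : ∀ m : Fin 1024, RuleA m = true → RuleY m = true := by
  decide +kernel

/-! ## Theorem 20 -/

section Locus

variable {R : Type*} [Field R] [LinearOrder R] [IsStrictOrderedRing R]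

omit [IsStrictOrderedRing R] in
/-- The base weights of an admissible `p` are admissible. -/
lemma isProbVec_castSucc {p : Fin 11 → R} (hp : ∀ e : Fin 11, 0 ≤ p e ∧ p e ≤ 1) :
    IsProbVec (p ∘ Fin.castSucc) := ⟨fun _ => (hp _).1, fun _ => (hp _).2⟩

/-- **THEOREM 20 — THE ZERO SIDE**: on every `A`-degenerate base edge set `m`, `Gc p ends6b 0 1 2 5 4 = 0` for every
admissible `p` whose `K₅` weights are supported on `m` — for EVERY pendant weight. -/
theorem gc6b_zero_of_face (m : ℕ) (hm : m < 1024) (hr : RuleA m = true) (p : Fin 11 → R)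
    (hp : ∀ e : Fin 11, 0 ≤ p e ∧ p e ≤ 1)
    (hp₀ : ∀ e : Fin 10, m.testBit e = false → p (Fin.castSucc e) = 0) :
    Gc p PendantB.ends6b 0 1 2 5 4 = 0 := by
  rw [gc6b_eq]
  set s := p ∘ Fin.castSucc with hs_def
  have hs : IsProbVec s := isProbVec_castSucc hp
  have hs₀ : ∀ e : Fin 10, m.testBit e = false → s e = 0 := fun e he => hp₀ e he
  -- `Y_L + Y_H = 0` on the face (`RuleA ⊆ RuleY`), hence both vanish
  have hY : YL s + YH s = 0 := by
    rw [Y_eq_bern]; exact y_K5_zero_of_face m hm (ruleY_of_ruleA ⟨m, hm⟩ hr) s hs₀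
  have hYL : YL s = 0 := by linarith [YL_nonneg' s hs, YH_nonneg' s hs]
  have hYH : YH s = 0 := by linarith [YL_nonneg' s hs, YH_nonneg' s hs]
  -- `2P (Z_L + Z_H) = 0` on the face
  have hI : 2 * Pm s * (ZL s + ZH s) = 0 := by
    rw [twoPZ_eq_bern]; exact i_K5_zero_of_face m hm hr s hs₀
  rcases (Pm_nonneg s hs).lt_or_eq with hP | hP
  · have hZ : ZL s + ZH s = 0 := by
      rcases mul_eq_zero.1 hI with h | h
      · exfalso; linarith
      · exact h
    have hZL : ZL s = 0 := by linarith [ZL_nonneg' s hs, ZH_nonneg' s hs]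
    have hZH : ZH s = 0 := by linarith [ZL_nonneg' s hs, ZH_nonneg' s hs]
    rw [hZL, hZH, hYL, hYH]; ring
  · -- `P = 0`: every mass under `Q` vanishes
    have hP0 : Pm s = 0 := hP.symm
    have hz : ∀ X : Set (Config (Fin 10)), prob s (Qev ∩ X) = 0 := fun X =>
      le_antisymm (by rw [← hP0]; exact prob_mono hs Set.inter_subset_left) (prob_nonneg hs _)
    have hbL : bLm s = 0 := hz _
    have hbH : bHm s = 0 := hz _
    have hD : Dm s = 0 := by unfold Dm; rw [hP0, hbL, hbH]; ring
    rw [hP0, hbL, hbH, hD, hYL, hYH]; ring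

/-- **THEOREM 20 — THE POSITIVE SIDE**: on every base edge set `m` that is not `A`-degenerate,
`0 < Gc p ends6b 0 1 2 5 4` at every weight vector interior on the base (`0 < p_e < 1` on `m`, `p_e = 0` off `m`)
with pendant weight `0 ≤ q < 1` — the first Bernstein term alone. -/
theorem gc6b_pos_of_face (m : ℕ) (hm : m < 1024) (hr : RuleA m = false) (p : Fin 11 → R)
    (hp₁ : ∀ e : Fin 10, m.testBit e = true → 0 < p (Fin.castSucc e) ∧ p (Fin.castSucc e) < 1)
    (hp₀ : ∀ e : Fin 10, m.testBit e = false → p (Fin.castSucc e) = 0)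
    (hq : 0 ≤ p (Fin.last 10) ∧ p (Fin.last 10) < 1) :
    0 < Gc p PendantB.ends6b 0 1 2 5 4 := by
  rw [gc6b_eq]
  set s := p ∘ Fin.castSucc with hs_def
  have h01 : ∀ e : Fin 10, 0 ≤ s e ∧ s e ≤ 1 := fun e => by
    by_cases he : m.testBit e = true
    · exact ⟨(hp₁ e he).1.le, (hp₁ e he).2.le⟩
    · show 0 ≤ p (Fin.castSucc e) ∧ p (Fin.castSucc e) ≤ 1
      rw [hp₀ e (by simpa using he)]
      exact ⟨le_rfl, zero_le_one⟩
  have hs : IsProbVec s := ⟨fun e => (h01 e).1, fun e => (h01 e).2⟩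
  have hlt : ∀ e, s e < 1 := fun e => by
    by_cases he : m.testBit e = true
    · exact (hp₁ e he).2
    · show p (Fin.castSucc e) < 1
      rw [hp₀ e (by simpa using he)]; exact zero_lt_one
  have hs₁ : ∀ e : Fin 10, m.testBit e = true → 0 < s e ∧ s e < 1 := fun e he => hp₁ e he
  have hs₀ : ∀ e : Fin 10, m.testBit e = false → s e = 0 := fun e he => hp₀ e he
  have hI : 0 < 2 * Pm s * (ZL s + ZH s) := by
    rw [twoPZ_eq_bern]; exact i_K5_pos_of_face m hm hr s hs₁ hs₀
  have hq1 : 0 < 1 - p (Fin.last 10) := sub_pos.2 hq.2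
  have e1 : 0 < (1 - p (Fin.last 10)) ^ 2 * (2 * Pm s * (ZL s + ZH s)) := mul_pos (pow_pos hq1 2) hI
  have hD := Dm_nonneg s hs
  have hmL : 0 ≤ 2 * bLm s + Dm s := by linarith [bLm_nonneg s hs]
  have hmH : 0 ≤ 2 * bHm s + Dm s := by linarith [bHm_nonneg s hs]
  have e2 : 0 ≤ 2 * p (Fin.last 10) * (1 - p (Fin.last 10)) *
      ((2 * bLm s + Dm s) * ZL s + (2 * bHm s + Dm s) * ZH s + Pm s * (YL s + YH s)) := by
    refine mul_nonneg (mul_nonneg (mul_nonneg zero_le_two hq.1) hq1.le) ?_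
    have := ZL_nonneg' s hs; have := ZH_nonneg' s hs; have := YL_nonneg' s hs; have := YH_nonneg' s hs
    have := Pm_nonneg s hs
    positivity
  have e3 : 0 ≤ p (Fin.last 10) ^ 2 *
      (2 * ((2 * bLm s + Dm s) * YL s + (2 * bHm s + Dm s) * YH s)) := by
    refine mul_nonneg (pow_nonneg hq.1 2) ?_
    have := YL_nonneg' s hs; have := YH_nonneg' s hs
    positivity
  linarith

/-- The centre of the base face with pendant weight `½`. -/
noncomputable def centreB (m : ℕ) : Fin 11 → R := Fin.snoc (α := fun _ => R) (centre m) (1 / 2)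

omit [LinearOrder R] [IsStrictOrderedRing R] in
/-- `centreB` on the `K₅` edges is the centre of `m`. -/
lemma centreB_castSucc (m : ℕ) (e : Fin 10) : centreB (R := R) m (Fin.castSucc e) = centre m e := by
  unfold centreB; simp [Fin.snoc_castSucc]

omit [LinearOrder R] [IsStrictOrderedRing R] in
/-- The pendant weight of `centreB` is `½`. -/
lemma centreB_last (m : ℕ) : centreB (R := R) m (Fin.last 10) = 1 / 2 :=
  Fin.snoc_last _ _

/-- `centreB` is admissible. -/
lemma centreB_01 (m : ℕ) : ∀ e : Fin 11, 0 ≤ centreB (R := R) m e ∧ centreB (R := R) m e ≤ 1 := by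
  intro e
  induction e using Fin.lastCases with
  | last => rw [centreB_last]; exact ⟨by norm_num, by norm_num⟩
  | cast e => rw [centreB_castSucc]; exact centre_01 m e

/-- **THEOREM 20, FIRST «IFF»**: on `K₅ + a₃ pendant at b`, `Gc > 0` at every weight vector interior on the base
face of `m` with pendant weight in `[0, 1)` ⟺ `m` is not `A`-degenerate. -/
theorem gc6b_pos_iff (m : ℕ) (hm : m < 1024) :
    (∀ p : Fin 11 → R, (∀ e : Fin 10, m.testBit e = true → 0 < p (Fin.castSucc e) ∧ p (Fin.castSucc e) < 1) →
      (∀ e : Fin 10, m.testBit e = false → p (Fin.castSucc e) = 0) →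
      (0 ≤ p (Fin.last 10) ∧ p (Fin.last 10) < 1) → 0 < Gc p PendantB.ends6b 0 1 2 5 4) ↔ RuleA m = false := by
  constructor
  · intro h
    rcases Bool.eq_false_or_eq_true (RuleA m) with hr | hr
    · exfalso
      have hpos := h (centreB (R := R) m) (fun e he => by rw [centreB_castSucc]; exact centre_on_pos he)
        (fun e he => by rw [centreB_castSucc]; exact centre_off he)
        (by rw [centreB_last]; exact ⟨by norm_num, by norm_num⟩)
      have hzero := gc6b_zero_of_face m hm hr (centreB (R := R) m) (centreB_01 m)
        (fun e he => by rw [centreB_castSucc]; exact centre_off he)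
      rw [hzero] at hpos
      exact lt_irrefl _ hpos
    · exact hr
  · intro hr p hp₁ hp₀ hq
    exact gc6b_pos_of_face m hm hr p hp₁ hp₀ hq

/-- **THEOREM 20, SECOND «IFF»**: on `K₅ + a₃ pendant at b`, `Gc = 0` at every admissible weight vector whose `K₅`
weights are supported on `m` (the pendant weight free) ⟺ `m` is `A`-degenerate. -/
theorem gc6b_zero_iff (m : ℕ) (hm : m < 1024) :
    (∀ p : Fin 11 → R, (∀ e : Fin 11, 0 ≤ p e ∧ p e ≤ 1) →
      (∀ e : Fin 10, m.testBit e = false → p (Fin.castSucc e) = 0) →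
      Gc p PendantB.ends6b 0 1 2 5 4 = 0) ↔ RuleA m = true := by
  constructor
  · intro h
    rcases Bool.eq_false_or_eq_true (RuleA m) with hr | hr
    · exact hr
    · exfalso
      have hpos := gc6b_pos_of_face m hm hr (centreB (R := R) m)
        (fun e he => by rw [centreB_castSucc]; exact centre_on_pos he)
        (fun e he => by rw [centreB_castSucc]; exact centre_off he)
        (by rw [centreB_last]; exact ⟨by norm_num, by norm_num⟩)
      have hzero := h (centreB (R := R) m) (centreB_01 m)
        (fun e he => by rw [centreB_castSucc]; exact centre_off he)
      rw [hzero] at hpos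
      exact lt_irrefl _ hpos
  · intro hr p hp hp₀
    exact gc6b_zero_of_face m hm hr p hp hp₀

/-! ## The glued face `q = 1`: the `a₃ = b` coincidence -/

/-- **The glued face**: with the pendant edge pinned open, `Gc` is `2 [(2bL + D) Y_L + (2bH + D) Y_H]`. -/
theorem gc6b_glued_eq (p : Fin 11 → R) :
    Gc (Function.update p (Fin.last 10) 1) PendantB.ends6b 0 1 2 5 4 =
      2 * ((2 * bLm (p ∘ Fin.castSucc) + Dm (p ∘ Fin.castSucc)) * YL (p ∘ Fin.castSucc) +
        (2 * bHm (p ∘ Fin.castSucc) + Dm (p ∘ Fin.castSucc)) * YH (p ∘ Fin.castSucc)) := by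
  rw [gc6b_eq, Pendant.update_comp_castSucc, Function.update_self]
  ring

/-- **THE GLUED FACE, «IFF»**: with `a₃` glued to `b`, `Gc = 0` at every admissible weight vector whose `K₅` weights
are supported on `m` ⟺ `m` is `Y`-degenerate (`o` cut off from one of `a₁, a₂, b` by the other two). -/
theorem gc6b_glued_zero_iff (m : ℕ) (hm : m < 1024) :
    (∀ p : Fin 11 → R, (∀ e : Fin 11, 0 ≤ p e ∧ p e ≤ 1) →
      (∀ e : Fin 10, m.testBit e = false → p (Fin.castSucc e) = 0) →
      Gc (Function.update p (Fin.last 10) 1) PendantB.ends6b 0 1 2 5 4 = 0) ↔ RuleY m = true := by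
  constructor
  · intro h
    rcases Bool.eq_false_or_eq_true (RuleY m) with hr | hr
    · exact hr
    · exfalso
      have hzero := h (centreB (R := R) m) (centreB_01 m)
        (fun e he => by rw [centreB_castSucc]; exact centre_off he)
      rw [gc6b_glued_eq] at hzero
      set s := centreB (R := R) m ∘ Fin.castSucc with hs_def
      have hs_eq : s = centre m := by funext e; simp [hs_def, centreB_castSucc]
      have hs : IsProbVec s := by rw [hs_eq]; exact ⟨fun e => (centre_01 m e).1, fun e => (centre_01 m e).2⟩
      have hlt : ∀ e, s e < 1 := fun e => by
        rw [hs_eq]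
        rcases Bool.eq_false_or_eq_true (m.testBit e) with h | h
        · rw [centre_on h]; exact one_half_lt_one
        · rw [centre_off h]; exact zero_lt_one
      have hY : 0 < YL s + YH s := by
        rw [Y_eq_bern, hs_eq]
        exact y_K5_pos_of_face m hm hr (centre m) (fun e he => centre_on_pos he) (fun e he => centre_off he)
      have hD := Dm_pos s hs hlt
      have h1 : 0 < 2 * bLm s + Dm s := by linarith [bLm_nonneg s hs]
      have h2 : 0 < 2 * bHm s + Dm s := by linarith [bHm_nonneg s hs]
      have : 0 < 2 * ((2 * bLm s + Dm s) * YL s + (2 * bHm s + Dm s) * YH s) := by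
        have hYL := YL_nonneg' s hs; have hYH := YH_nonneg' s hs
        rcases hYL.lt_or_eq with hL | hL
        · positivity
        · have hH : 0 < YH s := by linarith
          rw [← hL]; positivity
      linarith
  · intro hr p hp hp₀
    rw [gc6b_glued_eq]
    have hs : IsProbVec (p ∘ Fin.castSucc) := isProbVec_castSucc hp
    have hY : YL (p ∘ Fin.castSucc) + YH (p ∘ Fin.castSucc) = 0 := by
      rw [Y_eq_bern]; exact y_K5_zero_of_face m hm hr _ (fun e he => hp₀ e he)
    have hYL : YL (p ∘ Fin.castSucc) = 0 := by linarith [YL_nonneg' _ hs, YH_nonneg' _ hs]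
    have hYH : YH (p ∘ Fin.castSucc) = 0 := by linarith [YL_nonneg' _ hs, YH_nonneg' _ hs]
    rw [hYL, hYH]; ring

end Locus

end PM

end K5

end Summit.Ventures.PercRepro2
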